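import Literature.NumberTheory.NumberFields.EisensteinFieldLocal
import HarnessLib

/-!
# The Eisenstein field at `λ = ζ − 1`: reduction modulo `9 = λ⁴` and a digit character of level three

Topic `NumberTheory/NumberFields`. Local arithmetic of `K3 = ℚ(ζ₃)` at the ramified prime
`λ = ζ − 1` (`λ² = −3ζ`, `(9) = (λ⁴)`), in coordinates, for the condition at `λ` of the
`√−3`-descent on `y² = x³ + t²`, `t ≡ ±4 (mod 9)`
(`Literature/Barriers/BirchSwinnertonDyer/RankNotSumOfLocalInvariantsCubicTwists.lean`):

* `K3.vL` — the `λ`-adic valuation (`EisensteinFieldLocal.val` at `λ`), `vL 3 = exp(−2)`;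
  `λ`-integral elements are `(a + bζ)/c` with `3 ∤ c` (`exists_rep_lam`);
* `K3.red9 : K3 → R9`, `R9 = (ℤ/9)[ω]/(ω² + ω + 1) = ℤ[ζ]/9 = 𝓞_λ/λ⁴`, the reduction of
  `λ`-integral elements (defined through a representation `c x = a + bζ`, independent of it:
  `smul_red9_of_rep`), multiplicative and additive on `λ`-integral elements, mapping `λ`-units to
  units (`isUnit_red9`) and `λ³𝓞_λ` into `(ζ̄ − 1)³ R9` (`red9_of_vL_le_exp_neg_three`);
* `K3.muBar : R9 → ℤ/3ℤ` — on the `54` units `±(1+λ)^a (1+λ²)^b (1+λ³)^c` of `R9`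
  (`U/U⁴ ≅ {±1} × 𝔽₃³`, `U^i = 1 + λ^i`) the functional `a + 2b` (a table; its properties —
  a homomorphism on units, invariant under `+ (ζ̄ − 1)³ R9`, i.e. of LEVEL THREE, killing `±1`
  and `ω̄ = ζ̄`, with `muBar 2 = 2`, `muBar 5 = 1`, and the finite check
  `β(β − 1) = X³ ⟹ muBar β = 0` for units `β, X` — are verified by `decide`);
* `K3.mu : K3 → ℤ/3ℤ`, `mu x = muBar (red9 (x · λ^{log vL x}))` (read on the unit part): the
  axioms `MordellDescent.IsDigitChar` of
  `Literature/NumberTheory/EllipticCurves/MordellCurveCubicDescentLocal.lean` (`mu_mul`,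
  `mu_eq_of_vL_sub_le`, `mu_neg_one`), the values `mu ζ = 0`, `mu 2 = 2`, `mu 5 = 1`,
  `mu 10 = mu 100 = 0`, and the `hunits` check of loc. cit. for `2t ≡ 1 (mod 9)`
  (`mu_eq_zero_of_units`).

`muBar` is the functional `a − b` on `U¹/U⁴ = U¹/(U¹)³ ≅ 𝔽₃³` (coordinates w.r.t.
`1 + λ, 1 + λ², 1 + λ³`); it vanishes on `U³/U⁴`, which is what makes it a level-three character.
(It is NOT a cubic residue symbol.) Elementary; [folklore] throughout, with Ireland–Rosen Ch. 9 §1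
for `ℤ[ω]` at `λ`.

## References

* K. Ireland, M. Rosen, *A Classical Introduction to Modern Number Theory*, 2nd ed., GTM 84
  (1990), Ch. 9 §1 (`λ = 1 − ω`, `3 = −ω²λ²`, `ℤ[ω]/λℤ[ω] ≅ ℤ/3`). [IrelandRosen1990]
* J. H. Silverman, *The Arithmetic of Elliptic Curves*, 2nd ed., GTM 106 (2009), X.1, X.4,
  Exercise 10.9 (local images of the `3`-isogeny descent). [SilvermanAEC2009]
-/

noncomputable section

open QuadraticAlgebra NumberField IsDedekindDomain IsDedekindDomain.HeightOneSpectrum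
open WithZero (log exp)
open scoped WithZero

namespace Literature.NumberTheory.NumberFields

namespace K3

/-! ### The valuation at `λ` and `λ`-integral elements -/

/-- **The `λ`-adic valuation** of `K3` (`λ = ζ − 1`). [folklore] -/
abbrev vL : Valuation K3 ℤᵐ⁰ := val prime_lamInt

/-- `ζ − 1 ≠ 0`. [folklore] -/
theorem zeta_sub_one_ne_zero : (zeta - 1 : K3) ≠ 0 := fun h ↦ by
  have := congrArg QuadraticAlgebra.im h
  simp [zeta] at this

/-- `vL (ζ − 1) = exp(−1)`. [folklore] -/
theorem vL_zeta_sub_one : vL (zeta - 1) = exp (-1) := by rw [← coe_lamInt]; exact val_self _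

/-- `(ζ − 1)² = −3ζ` and `(ζ − 1)³ = 3 + 6ζ` in `K3`. [cite: IrelandRosen1990, Ch. 9 §1] -/
theorem zeta_sub_one_pow : (3 : K3) * zeta = -((zeta - 1) ^ 2) ∧ (zeta - 1) ^ 3 = 3 + 6 * zeta := by
  constructor
  · linear_combination zeta_sq
  · linear_combination zeta_pow_three - 3 * zeta_sq

/-- `λ² = −3ζ` in `𝓞 K3`. [cite: IrelandRosen1990, Prop. 9.1.4] -/
theorem lamInt_sq : lamInt ^ 2 = -(zetaInt * 3) := by
  have h3 := three_eq_neg_zetaInt_sq_mul_lamInt_sq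
  have hz : zetaInt ^ 3 = 1 := isPrimitiveRoot_zeta.toInteger_cube_eq_one
  calc lamInt ^ 2 = zetaInt ^ 3 * lamInt ^ 2 := by rw [hz, one_mul]
    _ = -(zetaInt * -(zetaInt ^ 2 * lamInt ^ 2)) := by ring
    _ = -(zetaInt * 3) := by rw [← h3]

/-- `3^e ∣ λ^{2e}`. [folklore] -/
theorem three_pow_dvd_lamInt_pow (e : ℕ) : (3 : 𝓞 K3) ^ e ∣ lamInt ^ (2 * e) := by
  rw [pow_mul, lamInt_sq, neg_pow, mul_pow]
  exact Dvd.intro_left ((-1) ^ e * zetaInt ^ e) (by ring)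

/-- `vL 3 = exp(−2)`. [folklore] -/
theorem vL_three : vL (3 : K3) = exp (-2) := by
  have key : vL (3 * zeta) = exp (-2) := by
    rw [zeta_sub_one_pow.1, Valuation.map_neg, Valuation.map_pow, vL_zeta_sub_one,
      ← WithZero.exp_nsmul]
    norm_num
  rwa [Valuation.map_mul, val_zeta, mul_one] at key

/-- `vL (3^e) = exp(−2e)`. [folklore] -/
theorem vL_three_pow (e : ℕ) : vL ((3 : K3) ^ e) = exp (-(2 * e : ℤ)) := by
  rw [Valuation.map_pow, vL_three, ← WithZero.exp_nsmul]; congr 1; simp; ring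

/-- **`λ`-integral elements in coordinates**: if `vL x ≤ 1` then `c · x = a + bζ` with `3 ∤ c`.
[cite: IrelandRosen1990, Ch. 9 §1] -/
theorem exists_rep_lam {x : K3} (hx : vL x ≤ 1) :
    ∃ (c : ℕ) (a b : ℤ), ¬ 3 ∣ c ∧ (c : K3) * x = ⟨a, b⟩ := by
  set d : ℕ := x.re.den * x.im.den with hd
  have hd0 : d ≠ 0 := mul_ne_zero x.re.den_nz x.im.den_nz
  obtain ⟨e, c, hc, hdec⟩ := Nat.exists_eq_pow_mul_and_not_dvd hd0 3 (by norm_num)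
  set A : ℤ := x.re.num * x.im.den
  set B : ℤ := x.im.num * x.re.den
  have hdx : (d : K3) * x = ((mkInt A B : 𝓞 K3) : K3) := by rw [coe_mkInt, hd, den_mul_eq_mk]
  have hvy : vL ((mkInt A B : 𝓞 K3) : K3) ≤ exp (-(2 * e : ℕ) : ℤ) := by
    rw [← hdx, hdec, Nat.cast_mul, Nat.cast_pow, Valuation.map_mul, Valuation.map_mul,
      show ((3 : ℕ) : K3) = 3 by norm_num, vL_three_pow, val_lam_natCast hc, mul_one]
    push_cast
    exact mul_le_of_le_one_right' hx
  obtain ⟨y', hy'⟩ := pow_dvd_of_val_coe_le prime_lamInt hvy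
  obtain ⟨y'', hy''⟩ := (three_pow_dvd_lamInt_pow e).trans (Dvd.intro _ hy'.symm)
  obtain ⟨a, b, rfl⟩ := exists_eq_mkInt y''
  refine ⟨c, a, b, hc, ?_⟩
  have hpe : ((3 : K3) ^ e) ≠ 0 := pow_ne_zero e (by norm_num)
  have key : (3 : K3) ^ e * ((c : K3) * x) = (3 : K3) ^ e * ⟨a, b⟩ := by
    have h1 : (3 : K3) ^ e * ((c : K3) * x) = (d : K3) * x := by
      rw [hdec]; push_cast; ring
    rw [h1, hdx, hy'']
    push_cast
    rfl
  exact mul_left_cancel₀ hpe key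

/-- Two representations are proportional: `c x = a + bζ`, `c' x = a' + b'ζ` ⟹ `c' a = c a'`,
`c' b = c b'`. [folklore] -/
theorem rep_unique {x : K3} {c c' : ℕ} {a b a' b' : ℤ} (h : (c : K3) * x = ⟨a, b⟩)
    (h' : (c' : K3) * x = ⟨a', b'⟩) : (c' : ℤ) * a = c * a' ∧ (c' : ℤ) * b = c * b' := by
  have e : (c' : K3) * ((c : K3) * x) = (c : K3) * ((c' : K3) * x) := by ring
  rw [h, h'] at e
  have h1 := congrArg QuadraticAlgebra.re e
  have h2 := congrArg QuadraticAlgebra.im e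
  simp only [re_mul, im_mul, re_natCast, im_natCast, mul_zero, zero_mul, add_zero] at h1 h2
  exact ⟨by exact_mod_cast h1, by exact_mod_cast h2⟩

/-! ### The residue ring `R9 = ℤ[ζ]/9` and the reduction map -/

/-- `R9 = (ℤ/9)[ω]/(ω² + ω + 1) = ℤ[ζ]/9 = 𝓞_λ/λ⁴`. [folklore] -/
abbrev R9 : Type := F 9

/-- `3 ∤ c ⟹ c̄` is a unit of `ℤ/9`. [folklore] -/
theorem isUnit_zmod_nine {c : ℕ} (hc : ¬ 3 ∣ c) : IsUnit (c : ZMod 9) := by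
  rw [ZMod.isUnit_iff_coprime]
  have h3 : Nat.Coprime c 3 := (Nat.coprime_comm.mp ((Nat.Prime.coprime_iff_not_dvd Nat.prime_three).mpr hc))
  simpa using h3.pow_right 2

open scoped Classical in
/-- **The reduction map `K3 → R9`** on `λ`-integral elements: `red9 x = c̄⁻¹ (ā + b̄ω)` for any
representation `c x = a + bζ`, `3 ∤ c` (and `0` if there is none). [folklore] -/
def red9 (x : K3) : R9 :=
  if h : ∃ r : ℕ × ℤ × ℤ, ¬ 3 ∣ r.1 ∧ (r.1 : K3) * x = ⟨r.2.1, r.2.2⟩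
  then ((h.choose.1 : ZMod 9))⁻¹ • ⟨(h.choose.2.1 : ZMod 9), (h.choose.2.2 : ZMod 9)⟩ else 0

/-- **`red9` on a representation**: `c x = a + bζ`, `3 ∤ c` ⟹ `c̄ • red9 x = ā + b̄ω`
(independence of the representation). [folklore] -/
theorem smul_red9_of_rep {x : K3} {c : ℕ} {a b : ℤ} (hc : ¬ 3 ∣ c) (h : (c : K3) * x = ⟨a, b⟩) :
    (c : ZMod 9) • red9 x = ⟨(a : ZMod 9), (b : ZMod 9)⟩ := by
  classical
  have hex : ∃ r : ℕ × ℤ × ℤ, ¬ 3 ∣ r.1 ∧ (r.1 : K3) * x = ⟨r.2.1, r.2.2⟩ := ⟨(c, a, b), hc, h⟩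
  rw [red9, dif_pos hex]
  obtain ⟨hr, hrx⟩ := hex.choose_spec
  set r := hex.choose with hrdef
  obtain ⟨h1, h2⟩ := rep_unique hrx h
  have hu : IsUnit ((r.1 : ℕ) : ZMod 9) := isUnit_zmod_nine hr
  have h1' : ((c : ℤ) : ZMod 9) * (r.2.1 : ZMod 9) = ((r.1 : ℤ) : ZMod 9) * a := by exact_mod_cast congrArg (Int.cast : ℤ → ZMod 9) h1
  have h2' : ((c : ℤ) : ZMod 9) * (r.2.2 : ZMod 9) = ((r.1 : ℤ) : ZMod 9) * b := by exact_mod_cast congrArg (Int.cast : ℤ → ZMod 9) h2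
  rw [Int.cast_natCast, Int.cast_natCast] at h1' h2'
  ext
  · simp only [re_smul, smul_eq_mul]
    calc (c : ZMod 9) * (((r.1 : ℕ) : ZMod 9)⁻¹ * (r.2.1 : ZMod 9))
        = ((r.1 : ℕ) : ZMod 9)⁻¹ * ((c : ZMod 9) * (r.2.1 : ZMod 9)) := by ring
      _ = ((r.1 : ℕ) : ZMod 9)⁻¹ * ((r.1 : ℕ) : ZMod 9) * a := by rw [h1', mul_assoc]
      _ = a := by rw [ZMod.inv_mul_of_unit _ hu, one_mul]
  · simp only [im_smul, smul_eq_mul]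
    calc (c : ZMod 9) * (((r.1 : ℕ) : ZMod 9)⁻¹ * (r.2.2 : ZMod 9))
        = ((r.1 : ℕ) : ZMod 9)⁻¹ * ((c : ZMod 9) * (r.2.2 : ZMod 9)) := by ring
      _ = ((r.1 : ℕ) : ZMod 9)⁻¹ * ((r.1 : ℕ) : ZMod 9) * b := by rw [h2', mul_assoc]
      _ = b := by rw [ZMod.inv_mul_of_unit _ hu, one_mul]

/-- `red9 (a + bζ) = ā + b̄ω`. [folklore] -/
theorem red9_mk (a b : ℤ) : red9 ⟨a, b⟩ = ⟨(a : ZMod 9), (b : ZMod 9)⟩ := by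
  have h := smul_red9_of_rep (x := ⟨a, b⟩) (c := 1) (by norm_num) (by push_cast; ring)
  rwa [Nat.cast_one, one_smul] at h

/-- `red9 n = n̄` for `n ∈ ℕ`. [folklore] -/
theorem red9_natCast (n : ℕ) : red9 (n : K3) = (n : R9) := by
  have h := red9_mk n 0
  have e1 : (⟨((n : ℤ) : ℚ), ((0 : ℤ) : ℚ)⟩ : K3) = (n : K3) := by ext <;> simp
  have e2 : (⟨((n : ℤ) : ZMod 9), ((0 : ℤ) : ZMod 9)⟩ : R9) = (n : R9) := by ext <;> simp
  rwa [e1, e2] at h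

/-- `red9 (−1) = −1`. [folklore] -/
theorem red9_neg_one : red9 (-1) = -1 := by
  have h := red9_mk (-1) 0
  have e1 : (⟨((-1 : ℤ) : ℚ), ((0 : ℤ) : ℚ)⟩ : K3) = -1 := by ext <;> simp
  have e2 : (⟨((-1 : ℤ) : ZMod 9), ((0 : ℤ) : ZMod 9)⟩ : R9) = -1 := by ext <;> simp
  rwa [e1, e2] at h

/-- `red9 ζ = ω`. [folklore] -/
theorem red9_zeta : red9 zeta = ω := by
  have h := red9_mk 0 1
  have e1 : (⟨((0 : ℤ) : ℚ), ((1 : ℤ) : ℚ)⟩ : K3) = zeta := by rw [zeta_eq]; ext <;> simp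
  rw [e1] at h; rw [h]; ext <;> simp

/-- `red9 ((ζ − 1)³) = 3 + 6ω` (`= −λ³`). [folklore] -/
theorem red9_zeta_sub_one_pow_three : red9 ((zeta - 1) ^ 3) = ⟨3, 6⟩ := by
  have e1 : ((zeta - 1) ^ 3 : K3) = ⟨((3 : ℤ) : ℚ), ((6 : ℤ) : ℚ)⟩ := by
    rw [zeta_sub_one_pow.2, zeta_eq]; ext <;> simp
  rw [e1, red9_mk]; push_cast; rfl

/-- **`red9` is multiplicative on `λ`-integral elements.** [folklore] -/
theorem red9_mul {x y : K3} (hx : vL x ≤ 1) (hy : vL y ≤ 1) : red9 (x * y) = red9 x * red9 y := by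
  obtain ⟨c, a, b, hc, hcx⟩ := exists_rep_lam hx
  obtain ⟨c', a', b', hc', hcy⟩ := exists_rep_lam hy
  have hcc : ¬ 3 ∣ c * c' := fun h ↦ (Nat.prime_three.dvd_mul.mp h).elim hc hc'
  have hrep : ((c * c' : ℕ) : K3) * (x * y) =
      ⟨((a * a' - b * b' : ℤ) : ℚ), ((a * b' + b * a' - b * b' : ℤ) : ℚ)⟩ := by
    rw [show ((c * c' : ℕ) : K3) * (x * y) = ((c : K3) * x) * ((c' : K3) * y) by push_cast; ring,
      hcx, hcy]
    ext
    · simp only [re_mul]; push_cast; ring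
    · simp only [im_mul]; push_cast; ring
  have h1 := smul_red9_of_rep hcc hrep
  have hprod : (⟨((a * a' - b * b' : ℤ) : ZMod 9), ((a * b' + b * a' - b * b' : ℤ) : ZMod 9)⟩ : R9) =
      ⟨(a : ZMod 9), (b : ZMod 9)⟩ * ⟨(a' : ZMod 9), (b' : ZMod 9)⟩ := by
    ext
    · simp only [re_mul]; push_cast; ring
    · simp only [im_mul]; push_cast; ring
  rw [hprod, ← smul_red9_of_rep hc hcx, ← smul_red9_of_rep hc' hcy, smul_mul_smul_comm,
    ← Nat.cast_mul] at h1
  exact (IsUnit.smul_left_cancel (isUnit_zmod_nine hcc)).mp h1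

/-- **`red9` is additive on `λ`-integral elements.** [folklore] -/
theorem red9_add {x y : K3} (hx : vL x ≤ 1) (hy : vL y ≤ 1) : red9 (x + y) = red9 x + red9 y := by
  obtain ⟨c, a, b, hc, hcx⟩ := exists_rep_lam hx
  obtain ⟨c', a', b', hc', hcy⟩ := exists_rep_lam hy
  have hcc : ¬ 3 ∣ c * c' := fun h ↦ (Nat.prime_three.dvd_mul.mp h).elim hc hc'
  have hrep : ((c * c' : ℕ) : K3) * (x + y) =
      ⟨((c' * a + c * a' : ℤ) : ℚ), ((c' * b + c * b' : ℤ) : ℚ)⟩ := by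
    rw [show ((c * c' : ℕ) : K3) * (x + y) = (c' : K3) * ((c : K3) * x) + (c : K3) * ((c' : K3) * y) by
      push_cast; ring, hcx, hcy]
    ext
    · simp only [re_add, re_mul, re_natCast, im_natCast]; push_cast; ring
    · simp only [im_add, im_mul, re_natCast, im_natCast]; push_cast; ring
  have h1 := smul_red9_of_rep hcc hrep
  have h2 : ((c * c' : ℕ) : ZMod 9) • (red9 x + red9 y) =
      ⟨((c' * a + c * a' : ℤ) : ZMod 9), ((c' * b + c * b' : ℤ) : ZMod 9)⟩ := by
    rw [smul_add, show ((c * c' : ℕ) : ZMod 9) • red9 x = (c' : ZMod 9) • ((c : ZMod 9) • red9 x) by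
        rw [smul_smul]; push_cast; ring_nf,
      show ((c * c' : ℕ) : ZMod 9) • red9 y = (c : ZMod 9) • ((c' : ZMod 9) • red9 y) by
        rw [smul_smul]; push_cast; ring_nf,
      smul_red9_of_rep hc hcx, smul_red9_of_rep hc' hcy]
    ext
    · simp only [re_add, re_smul, smul_eq_mul]; push_cast; ring
    · simp only [im_add, im_smul, smul_eq_mul]; push_cast; ring
  rw [← h2] at h1
  exact (IsUnit.smul_left_cancel (isUnit_zmod_nine hcc)).mp h1

/-- `red9 (−x) = −red9 x` on `λ`-integral elements. [folklore] -/
theorem red9_neg {x : K3} (hx : vL x ≤ 1) : red9 (-x) = -red9 x := by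
  rw [← neg_one_mul, red9_mul (by rw [Valuation.map_neg, Valuation.map_one]) hx, red9_neg_one, neg_one_mul]

/-- `red9 1 = 1`. [folklore] -/
theorem red9_one : red9 1 = 1 := by have := red9_natCast 1; simpa using this

/-- **`λ`-units reduce to units of `R9`** (`red9 (x) red9 (x⁻¹) = red9 1 = 1`). [folklore] -/
theorem isUnit_red9 {x : K3} (hx : vL x = 1) : IsUnit (red9 x) := by
  have hx0 : x ≠ 0 := fun h ↦ by rw [h, Valuation.map_zero] at hx; exact zero_ne_one hx
  have hinv : vL x⁻¹ = 1 := by rw [Valuation.map_inv, hx, inv_one]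
  refine IsUnit.of_mul_eq_one (red9 x⁻¹) ?_
  rw [← red9_mul hx.le hinv.le, mul_inv_cancel₀ hx0, red9_one]

/-- **Elements of `λ³𝓞_λ` reduce into `(ζ̄ − 1)³ R9`.** [folklore] -/
theorem red9_of_vL_le_exp_neg_three {x : K3} (hx : vL x ≤ exp (-3)) :
    ∃ s : R9, red9 x = ⟨3, 6⟩ * s := by
  have hl0 : (zeta - 1 : K3) ≠ 0 := zeta_sub_one_ne_zero
  have hl3 : vL ((zeta - 1) ^ 3) = exp (-3) := by
    rw [Valuation.map_pow, vL_zeta_sub_one, ← WithZero.exp_nsmul]; norm_num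
  set x' := x * ((zeta - 1) ^ 3)⁻¹ with hx'
  have hx'v : vL x' ≤ 1 := by
    rw [hx', Valuation.map_mul, Valuation.map_inv, hl3, ← WithZero.exp_neg, neg_neg]
    calc vL x * exp 3 ≤ exp (-3) * exp 3 := mul_le_mul_left hx _
      _ = 1 := by rw [← WithZero.exp_add]; norm_num
  refine ⟨red9 x', ?_⟩
  have hxx : x = (zeta - 1) ^ 3 * x' := by
    rw [hx', mul_comm, mul_assoc, inv_mul_cancel₀ (pow_ne_zero 3 hl0), mul_one]
  have h31 : exp (-3 : ℤ) ≤ (1 : ℤᵐ⁰) := by rw [← WithZero.exp_zero, WithZero.exp_le_exp]; norm_num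
  rw [hxx, red9_mul (hl3.le.trans h31) hx'v, red9_zeta_sub_one_pow_three]

/-! ### The digit functional `muBar` on the units of `R9` -/

/-- The table of `muBar` on `R9`, indexed by the coordinates `(re, im) ∈ (ℤ/9)²`: on the unit
`±(1+λ)^a (1+λ²)^b (1+λ³)^c` the value `a + 2b`, and `0` on non-units. [folklore] -/
def muTable : List (List (ZMod 3)) :=
  [[0, 0, 2, 0, 1, 1, 0, 2, 0],
   [0, 0, 0, 1, 2, 0, 2, 1, 0],
   [2, 0, 2, 1, 0, 0, 0, 0, 1],
   [0, 1, 1, 0, 2, 0, 0, 0, 2],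
   [1, 2, 0, 2, 1, 0, 0, 0, 0],
   [1, 0, 0, 0, 0, 1, 2, 0, 2],
   [0, 2, 0, 0, 0, 2, 0, 1, 1],
   [2, 1, 0, 0, 0, 0, 1, 2, 0],
   [0, 0, 1, 2, 0, 2, 1, 0, 0]]

/-- **The digit functional** `muBar : R9 → ℤ/3ℤ`: `a + 2b` on the unit
`±(1+λ)^a (1+λ²)^b (1+λ³)^c` (`U/U⁴ ≅ {±1} × 𝔽₃³`), `0` on non-units. [folklore] -/
def muBar (r : R9) : ZMod 3 := (muTable.getD r.re.val []).getD r.im.val 0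

/-- The unit criterion in `R9`: `a + bω` is a unit iff `a + b ≢ 0 (mod 3)` (the residue map
`R9 → ℤ[ζ]/λ = 𝔽₃` is `a + bω ↦ a + b`). [cite: IrelandRosen1990, Ch. 9 §1] -/
def UnitCrit (r : R9) : Prop := (r.re + r.im).val % 3 ≠ 0

/-- `UnitCrit` is decidable. [folklore] -/
instance decUnitCrit : DecidablePred UnitCrit := fun r ↦ by unfold UnitCrit; infer_instance

set_option maxRecDepth 20000 in
set_option maxHeartbeats 4000000 in
/-- The unit criterion is correct (finite check). [folklore] -/
theorem exists_inv_iff_unitCrit : ∀ r : R9, (∃ s : R9, r * s = 1) ↔ UnitCrit r := by decide +kernel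

/-- `IsUnit r ↔ UnitCrit r`. [folklore] -/
theorem isUnit_iff_unitCrit (r : R9) : IsUnit r ↔ UnitCrit r := by
  rw [← exists_inv_iff_unitCrit]
  exact ⟨fun h ↦ ⟨↑h.unit⁻¹, h.mul_val_inv⟩, fun ⟨s, hs⟩ ↦ IsUnit.of_mul_eq_one s hs⟩

/-- Decidability of `IsUnit` on `R9` through the criterion (so that `decide` can use it).
[folklore] -/
instance decIsUnitR9 : DecidablePred (fun r : R9 ↦ IsUnit r) :=
  fun r ↦ decidable_of_iff _ (isUnit_iff_unitCrit r).symm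

set_option maxRecDepth 20000 in
set_option maxHeartbeats 4000000 in
/-- **`muBar` is a homomorphism on units** (finite check). [folklore] -/
theorem muBar_mul : ∀ r s : R9, IsUnit r → IsUnit s → muBar (r * s) = muBar r + muBar s := by
  decide +kernel

set_option maxRecDepth 20000 in
set_option maxHeartbeats 4000000 in
/-- **`muBar` has level three**: it is invariant under `+ (ζ̄ − 1)³ R9` (finite check). [folklore] -/
theorem muBar_add_L3_mul : ∀ r s : R9, IsUnit r → muBar (r + ⟨3, 6⟩ * s) = muBar r := by
  decide +kernel

set_option maxRecDepth 20000 in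
set_option maxHeartbeats 4000000 in
/-- **The finite check at `λ` for `t ≡ ±4 (mod 9)`** (`2t ≡ 1 (mod 9)` after a sign): for units
`β, X` of `R9` with `β(β − 1) = X³`, `muBar β = 0`. [folklore] -/
theorem muBar_eq_zero_of_mul_sub_one_eq_cube :
    ∀ β X : R9, IsUnit β → IsUnit X → β * (β - 1) = X ^ 3 → muBar β = 0 := by
  decide +kernel

set_option maxRecDepth 20000 in
/-- `muBar 1 = 0`, `muBar (−1) = 0`, `muBar ω = 0` (`ζ`), `muBar 2 = 2`, `muBar 5 = 1`,
`muBar 10 = muBar 100 = 0`. [folklore] -/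
theorem muBar_values : muBar 1 = 0 ∧ muBar (-1) = 0 ∧ muBar (ω : R9) = 0 ∧ muBar (2 : R9) = 2 ∧
    muBar (5 : R9) = 1 ∧ muBar ((10 : ℕ) : R9) = 0 ∧ muBar ((100 : ℕ) : R9) = 0 := by
  decide +kernel

/-! ### The digit character `mu` on `K3` -/

/-- **The unit part at `λ`**: `x · (ζ − 1)^{log vL x}`. [folklore] -/
def unitPartL (x : K3) : K3 := x * (zeta - 1) ^ (log (vL x))

/-- `vL (unitPartL x) = 1` (`x ≠ 0`). [folklore] -/
theorem vL_unitPartL {x : K3} (hx : x ≠ 0) : vL (unitPartL x) = 1 := by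
  have hvx : vL x ≠ 0 := (Valuation.ne_zero_iff _).mpr hx
  rw [unitPartL, Valuation.map_mul, map_zpow₀, vL_zeta_sub_one, ← WithZero.exp_zsmul, smul_neg,
    zsmul_eq_mul, mul_one, Int.cast_id]
  nth_rewrite 1 [← WithZero.exp_log hvx]
  rw [← WithZero.exp_add, add_neg_cancel, WithZero.exp_zero]

/-- `unitPartL (x y) = unitPartL x · unitPartL y` (`x, y ≠ 0`). [folklore] -/
theorem unitPartL_mul {x y : K3} (hx : x ≠ 0) (hy : y ≠ 0) :
    unitPartL (x * y) = unitPartL x * unitPartL y := by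
  rw [unitPartL, unitPartL, unitPartL, Valuation.map_mul,
    WithZero.log_mul ((Valuation.ne_zero_iff _).mpr hx) ((Valuation.ne_zero_iff _).mpr hy),
    zpow_add₀ zeta_sub_one_ne_zero]
  ring

/-- `unitPartL x = x` when `vL x = 1`. [folklore] -/
theorem unitPartL_of_vL_eq_one {x : K3} (hx : vL x = 1) : unitPartL x = x := by
  rw [unitPartL, hx, WithZero.log_one, zpow_zero, mul_one]

/-- **The digit character** `mu x = muBar (red9 (unitPartL x))`. [folklore] -/
def mu (x : K3) : ZMod 3 := muBar (red9 (unitPartL x))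

/-- **`mu` is multiplicative on `K3ˣ`.** [folklore] -/
theorem mu_mul {x y : K3} (hx : x ≠ 0) (hy : y ≠ 0) : mu (x * y) = mu x + mu y := by
  rw [mu, mu, mu, unitPartL_mul hx hy, red9_mul (vL_unitPartL hx).le (vL_unitPartL hy).le]
  exact muBar_mul _ _ (isUnit_red9 (vL_unitPartL hx)) (isUnit_red9 (vL_unitPartL hy))

/-- **`mu` has level three**: `vL (y − x) ≤ vL x · exp(−3) ⟹ mu y = mu x` (`x ≠ 0`). [folklore] -/
theorem mu_eq_of_vL_sub_le {x y : K3} (hx : x ≠ 0) (h : vL (y - x) ≤ vL x * exp (-3)) :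
    mu y = mu x := by
  have hvx : vL x ≠ 0 := (Valuation.ne_zero_iff _).mpr hx
  have hlt : vL (y - x) < vL x := by
    calc vL (y - x) ≤ vL x * exp (-3) := h
      _ < vL x * 1 := by
          refine mul_lt_mul_of_pos_left ?_ (zero_lt_iff.mpr hvx)
          rw [← WithZero.exp_zero, WithZero.exp_lt_exp]; norm_num
      _ = vL x := mul_one _
  have hval : vL y = vL x := Valuation.map_eq_of_sub_lt _ hlt
  set L := log (vL x) with hL
  have hux : unitPartL x = x * (zeta - 1) ^ L := rfl
  have huy : unitPartL y = y * (zeta - 1) ^ L := by rw [unitPartL, hval]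
  set d := (y - x) * (zeta - 1) ^ L with hd
  have hpL : vL ((zeta - 1) ^ L) = exp (-L) := by
    rw [map_zpow₀, vL_zeta_sub_one, ← WithZero.exp_zsmul, smul_neg, zsmul_eq_mul, mul_one, Int.cast_id]
  have hdval : vL d ≤ exp (-3) := by
    rw [hd, Valuation.map_mul, hpL]
    calc vL (y - x) * exp (-L) ≤ vL x * exp (-3) * exp (-L) := mul_le_mul_left h _
      _ = exp (-3) := by
          nth_rewrite 1 [← WithZero.exp_log hvx]
          rw [← hL, ← WithZero.exp_add, ← WithZero.exp_add]; congr 1; ring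
  obtain ⟨s, hs⟩ := red9_of_vL_le_exp_neg_three hdval
  have h31 : exp (-3 : ℤ) ≤ (1 : ℤᵐ⁰) := by rw [← WithZero.exp_zero, WithZero.exp_le_exp]; norm_num
  have hsum : unitPartL y = unitPartL x + d := by rw [huy, hux, hd]; ring
  rw [mu, mu, hsum, red9_add (vL_unitPartL hx).le (hdval.trans h31), hs]
  exact muBar_add_L3_mul _ _ (isUnit_red9 (vL_unitPartL hx))

/-- `mu (−1) = 0`. [folklore] -/
theorem mu_neg_one : mu (-1) = 0 := by
  rw [mu, unitPartL_of_vL_eq_one (by rw [Valuation.map_neg, Valuation.map_one]), red9_neg_one]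
  exact muBar_values.2.1

/-- `mu ζ = 0`. [folklore] -/
theorem mu_zeta : mu zeta = 0 := by
  rw [mu, unitPartL_of_vL_eq_one (val_zeta _), red9_zeta]
  exact muBar_values.2.2.1

/-- `mu n = muBar n̄` for a natural `n` prime to `3`. [folklore] -/
theorem mu_natCast {n : ℕ} (hn : ¬ 3 ∣ n) : mu (n : K3) = muBar (n : R9) := by
  rw [mu, unitPartL_of_vL_eq_one (val_lam_natCast hn), red9_natCast]

/-- `mu 2 = 2`, `mu 5 = 1`, `mu 10 = 0`, `mu 100 = 0`. [folklore] -/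
theorem mu_values : mu 2 = 2 ∧ mu 5 = 1 ∧ mu ((10 : ℕ) : K3) = 0 ∧ mu ((100 : ℕ) : K3) = 0 := by
  refine ⟨?_, ?_, ?_, ?_⟩
  · have := mu_natCast (n := 2) (by norm_num); rw [Nat.cast_ofNat] at this
    rw [this]; exact muBar_values.2.2.2.1
  · have := mu_natCast (n := 5) (by norm_num); rw [Nat.cast_ofNat] at this
    rw [this]; exact muBar_values.2.2.2.2.1
  · rw [mu_natCast (by norm_num)]; exact muBar_values.2.2.2.2.2.1
  · rw [mu_natCast (by norm_num)]; exact muBar_values.2.2.2.2.2.2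

/-- `mu (s) = 0` for `s = ±1`. [folklore] -/
theorem mu_sign {s : ℤ} (hs : s = 1 ∨ s = -1) : mu (s : K3) = 0 := by
  rcases hs with rfl | rfl
  · rw [Int.cast_one, mu, unitPartL_of_vL_eq_one (Valuation.map_one _), red9_one]; exact muBar_values.1
  · rw [Int.cast_neg, Int.cast_one]; exact mu_neg_one

/-- `mu (xⁿ) = n mu x`. [folklore] -/
theorem mu_pow {x : K3} (hx : x ≠ 0) (n : ℕ) : mu (x ^ n) = n * mu x := by
  induction n with
  | zero =>
    rw [pow_zero, Nat.cast_zero, zero_mul, mu, unitPartL_of_vL_eq_one (Valuation.map_one _), red9_one]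
    exact muBar_values.1
  | succ n ih => rw [pow_succ, mu_mul (pow_ne_zero n hx) hx, ih]; push_cast; ring

/-- `mu (w³) = 0`. [folklore] -/
theorem mu_pow_three {x : K3} (hx : x ≠ 0) : mu (x ^ 3) = 0 := by
  rw [mu_pow hx 3]
  have h3 : ∀ a : ZMod 3, (3 : ℕ) * a = 0 := by decide
  exact h3 _

/-- **The finite check at `λ`, lifted to `K3`**: if `β, β − 2B, X` are `λ`-units with
`β(β − 2B) = X³` and `2B ≡ 1 (mod 9)` (`2B ∈ ℕ`), then `mu β = 0`. [folklore] -/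
theorem mu_eq_zero_of_units {B : ℕ} (hB : 2 * B % 9 = 1) {β X : K3} (hβ : vL β = 1)
    (hX : vL X = 1) (h : β * (β - 2 * B) = X ^ 3) : mu β = 0 := by
  have h3B : ¬ 3 ∣ 2 * B := fun h3 ↦ by omega
  have hv2B : vL ((2 * B : ℕ) : K3) = 1 := val_lam_natCast h3B
  have hred2B : red9 ((2 * B : ℕ) : K3) = 1 := by
    have h9 : ((2 * B : ℕ) : ZMod 9) = 1 := by
      rw [← Nat.mod_add_div (2 * B) 9, hB]; push_cast; rw [show (9 : ZMod 9) = 0 from rfl]; ring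
    rw [red9_natCast]
    ext
    · rw [re_natCast, h9]; rfl
    · rw [im_natCast]; rfl
  have hβ1 : vL (β - 2 * B) ≤ 1 := by
    refine (Valuation.map_sub _ _ _).trans (max_le hβ.le ?_)
    exact_mod_cast hv2B.le
  have hmul : red9 β * red9 (β - 2 * B) = red9 X ^ 3 := by
    rw [← red9_mul hβ.le hβ1, h, pow_succ, pow_two, red9_mul (by
      rw [Valuation.map_mul, hX, one_mul]) hX.le, red9_mul hX.le hX.le]; ring
  have hsub : red9 (β - 2 * B) = red9 β - 1 := by
    rw [sub_eq_add_neg, red9_add hβ.le (by rw [Valuation.map_neg]; exact_mod_cast hv2B.le),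
      show (-(2 * B : K3)) = -(((2 * B : ℕ) : K3)) by push_cast; ring,
      red9_neg (by exact_mod_cast hv2B.le), hred2B]; ring
  rw [hsub] at hmul
  rw [mu, unitPartL_of_vL_eq_one hβ]
  exact muBar_eq_zero_of_mul_sub_one_eq_cube _ _ (isUnit_red9 hβ) (isUnit_red9 hX) hmul

end K3

end Literature.NumberTheory.NumberFields

end
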